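import Literature.AlgebraicGeometry.Deformation.LocalHilbertFunctorHullDimensionBound
import Literature.AlgebraicGeometry.Deformation.LocalHilbertFunctorRegularImmersionObstructionTheory
import Literature.AlgebraicGeometry.Deformation.SmallExtensionFactorization
import Literature.AlgebraicGeometry.Motives.VarietiesProperProofs
import HarnessLib

/-!
# Obstructions of `H_Z^X` in the kernel of a linear map `θ` on `H¹(Z, 𝒩_{Z/X})` ⇒ the hull is cut out by at most `dim ker θ`
# equations and `dim R ≥ h⁰(Z, 𝒩_{Z/X}) − dim ker θ`; `θ` injective ⇒ `R = k[[x_1, …, x_{h⁰(𝒩)}]]` and `H_Z^X` is smooth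
# ([BuchweitzFlenner2003, Prop. 6.13 (2) ∕ Thm. 7.9] SHAPE for the local Hilbert functor; the kernel hypothesis is ASSUMED)

Layer `Literature/AlgebraicGeometry/Deformation` (family `hodge`; literature-typing tranche LT-H1 «semiregularity consumers», cell
`pub-hsemireg`, Ventures-side typer #2; census §6 (ii)∕(iv) «hulls ∕ dimension clauses BF 7.3 (1), 7.9 (2)» and item (c) «the
semiregularity map annihilates ALL obstructions»). THEOREMS only (0 definitions, 0 named facts, no `sorry`, no instance, no notation).

## Sources, verbatim

* [BuchweitzFlenner2003] Compositio Math. 137 (2003) (= arXiv:math∕9912245, held `paper:arxiv-math_9912245`). **Prop. 6.13 (2)**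
  [p0030:L139–156]: «If there exists a transformation `ψ : Ob(a, ℳ) → G(ℳ)` into a left exact functor `G` […] 2. If `a` is formally
  versal then `dim S ≥ dim_ℂ Ex(a₀, ℂ) − dim_ℂ K` with `K := ker(Ob(a, ℂ) → G(ℂ))`.»; **Thm. 7.9** [p0033:L144 – p0034:L3] (`Z ⊆ X`
  closed in a complex space, `S` the basis of a formally semiuniversal deformation, `τ` the semiregularity map on `T²_{Z∕X}(𝒪_Z)`):
  «1. The dimension of `S` satisfies `dim S ≥ dim_ℂ T¹_{X∕Z}(𝒪_Z) − dim_ℂ ker τ`. 2. If `Z` is compact then `dim_{[Z]} H_X ≥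
  dim_ℂ T¹_{X∕Z}(𝒪_Z) − dim_ℂ ker τ`. In particular, if `τ` is injective then `H_X` is smooth at `[Z]`.»; **Rem. 7.11 (1)** [p0034:L26–32]: for a locally
  complete intersection, «the statements […] hold with `T²_{Z∕X}(𝒪_Z)` replaced by `H¹(Z, 𝒩_{Z∕X})`.»; **Thm. 7.3**, last sentence
  [p0032:L112–128]: «`dim S ≥ dim_ℂ Ext¹_X(ℱ₀, ℱ₀) − dim_ℂ ker σ`. In particular, if `σ` is injective then `S` is smooth.»
* [BandieraLepriManetti2023] Adv. Math. 435 (2023) 109358, **Cor. 1.2** [corpus:paper:doi-10-1016-j-aim-2023-109358 p0003:L39–42]: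
  «Let `Z` be a codimension `p` locally complete intersection subvariety of a smooth complex projective manifold `X`. Then every
  obstruction to embedded deformations of `Z` is contained in the kernel of Bloch's semiregularity map
  `H¹(Z, N_{Z|X}) → H^{p+1}(X, Ω^{p−1}_X)`.»; §1 [arXiv:2111.12985 p0001:L30–41]: «`H¹(Z, N_{Z|X})` is an obstruction space for the
  Hilbert functor of the closed immersion `Z ⊂ X` […] if the semiregularity map is injective, then `Z` has unobstructed embedded
  deformations in `X`.»
* [IaconoManetti2013SemiregularityCI] Adv. Math. 235 (2013), §6 p. 14: «the obstructions of the functor […] are contained in the kernel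
  of the induced map» (tree `ArtinFunctor.ObstructionTheory.restrictKer`, `CompatibleObstructionTheories.lean` §4).
* [Hartshorne2010] GTM 257: §15 Ex. 15.5 (b) [chunk p0126:L9] «if `(R, ξ)` is a miniversal family, then `dim R ≥ dim t_F − dim V`»;
  §11 Thm. 11.1 [p0100:L17] «`I` can be generated by at most `dim V` elements», Cor. 11.2 [p0101:L5], Thm. 11.3 [p0101:L11–13]
  (embedding dimension `h⁰(Y, 𝒩)`); Thm. 6.2 (b) p. 47 and Cor. 9.3 p. 85 (the obstruction theory of `H_Z^X` in `H¹(Z, 𝒩_{Z∕X})`).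

## What this file proves (the passage «obstructions lie in `ker θ`» ⟹ «equations ∕ dimension ∕ smoothness»; NOT the kernel statement)

§0 (any `F : ArtinFunctor`; tree `ObstructionTheory`, `IsComplete`, `restrictKer`): `ObstructionTheory.isSmooth(Small)_of_annihilates_of_injective`
(complete `(V, v_e)` killed by an INJECTIVE `θ : V → W` ⇒ `F` smooth); `ProRep.powerSeries_le_ringKrullDim_add_finrank_ker_of_annihilates`
(presented hull `ν : h_{k[[x_1..x_n]]∕I} → F`, `I ⊆ 𝔪²`, complete `(V, v_e)`, `(θ ⊗ 1)(v_e) = 0`, `dim ker θ < ∞` ⇒ `I` generated by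
`≤ dim ker θ` series and **`n ≤ dim (k[[x]]∕I) + dim ker θ`** — `restrictKer` + the tree's Ex. 15.5 (b)
`powerSeries_le_ringKrullDim_add_finrank_of_isSmoothMapSmall`); `…_exists_ringKrullDim_eq_…` (`ℕ` form); `…_ideal_eq_bot_…` (`ker θ = 0` ⇒ `I = 0`).
§1 (`H_Z^X = localHilbertFunctor X ι₀.ker`, `X` locally Noetherian, `Z ≠ ∅`, `V = H¹(Z, 𝒩_{Z∕X})` via `localHilbertFunctor.normalObstructionTheory`
[Thm. 6.2 (b)] or `…OfRegularImmersion` [Cor. 9.3]), presented-hull form: `localHilbertFunctor.powerSeries_le_ringKrullDim_add_finrank_ker_of_annihilates`,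
`localHilbertFunctor_isSmooth_of_annihilates_of_injective` (+ `_of_isRegularImmersionOfCodim` versions).
§2 (`Z ⊂ X` a PROPER regular immersion of constant codimension, `Z ≠ ∅`; HULL form on `localHilbertFunctor_hull_ringForm_of_isProper`,
Thm. 7.9 (2) SHAPE with Rem. 7.11 (1)): **`localHilbertFunctor_hull_dimension_bound_of_annihilates`** — hull `R = k[[x_1, …, x_n]]∕J`,
**`n = h⁰(Z, 𝒩_{Z∕X})`**, `J ⊆ 𝔫²` generated by `≤ dim_k ker θ` series, **`h⁰(Z, 𝒩_{Z∕X}) ≤ dim R + dim_k ker θ`**;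
**`localHilbertFunctor_hullIdeal_eq_bot_of_annihilates_of_injective`** — `θ` injective ⇒ **`J = 0`** and `H_Z^X` smooth.
§3 (`k = ℂ`, `X` smooth projective, `ι₀` a regular immersion of codimension `p` — the binders of the tree's fact
`Bloch1972_hilbertScheme_smoothAt_semiregular`): `HodgeTheory.localHilbertFunctor_hull_dimension_bound_of_annihilates_smoothProjective`
(`ℕ` form) and `HodgeTheory.localHilbertFunctor_isSmooth_of_annihilates_of_injective_smoothProjective`, for ANY `ℂ`-linear `θ` containing all
obstructions in its kernel ([BandieraLepriManetti2023, Cor. 1.2]'s CONCLUSION as the hypothesis on `θ`), WITHOUT the typed Bloch fact.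

HONEST SCOPE. (1) «Every obstruction lies in `ker θ`» is a HYPOTHESIS on an ABSTRACT `k`-linear `θ`; in print `θ` is Bloch's `π` ∕ BF's
`τ` ∕ BLM's `σ` and the statement is the OUTPUT of Hodge theory ([BuchweitzFlenner2003, Prop. 6.13 (1)]; [BandieraLepriManetti2023,
Cor. 1.2]). Bloch's map on the tree's carrier `HodgeTheory.normalSheafCohomology ι₀ 1` is NOT typed (the tree keeps the Serre-dual
`blochPairingMap` ∕ `IsBlochSemiregular` and the named fact `Bloch1972_hilbertScheme_smoothAt_semiregular`): NO instance `θ := π` is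
asserted. (2) Print's `dim_{[Z]} H_X` ∕ `S` is the germ of the Douady ∕ Hilbert SPACE; here `R` is the HULL of the local Hilbert FUNCTOR of
`Z ⊂ X` in the trivial family (the `LocalHilbertFunctor*` series); `𝒪̂_{Hilb,[Z]} =` hull is not typed. (3) BF's own mechanism (left exact
`G` on `Coh_art(S)`, injective hulls) is not reproduced; the FM-language co-restriction to `ker θ` is used, which needs the kernel
statement for ALL small extensions. Grade: REFEREED (Compositio 2003; Adv. Math. 2013, 2023; GTM 257). Nothing here asserts HC ∕ HC_CM ∕
HC_AV ∕ W₆ ∕ HC_Kum4Type, Bloch's theorem, or that any geometric obstruction lies in any kernel.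

## References
* [BuchweitzFlenner2003] Compositio Math. 137 (2003): Prop. 6.13, Cor. 6.15, Thm. 7.3, Thm. 7.9, Cor. 7.10, Rem. 7.11 (1).
* [BandieraLepriManetti2023] Adv. Math. 435 (2023) 109358: §1, Cor. 1.2. [IaconoManetti2013SemiregularityCI] Adv. Math. 235: §6 p. 14.
* [Hartshorne2010] GTM 257: Thm. 6.2 (b), Cor. 9.3, Thm. 11.1, Cor. 11.2, Thm. 11.3, §15 Ex. 15.5 (b), Thm. 16.2, Thm. 17.1.
* [FantechiManetti1998ObstructionCalculus] Ex. 6.7. [Manetti1999DeformationTheoryDGLA] Def. 2.12–2.14, Prop. 2.18. [Schlessinger1968]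
  Remarks (2.3), 2.10, Thm. 2.11. [StacksProject] Tag 06HH. [Bloch1972Semiregularity] Thm. (7.3).
-/

noncomputable section

-- `(X ⊗ T).left = pullback X.hom T.hom` is `rfl` (`Over.tensorObj_left`) only at default transparency; as in the parents
set_option backward.isDefEq.respectTransparency false -- `HilbTangentSheafNormalSheafIso.lean` ∕ Mathlib's `Cartesian.Over`

open CategoryTheory Limits IsLocalRing _root_.AlgebraicGeometry Literature.AlgebraicGeometry.Motives
open scoped TensorProduct

universe u

namespace Literature.AlgebraicGeometry.Deformation

/-! ## §0 Functors of Artin rings: obstructions killed by `θ` ⇒ `dim R ≥ dim T¹ − dim ker θ`; `θ` injective ⇒ smooth -/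

section Generic

variable {k : Type u} [Field k] {F : ArtinFunctor.{u} k} {V W : Type u} [AddCommGroup V] [Module k V] [AddCommGroup W]
  [Module k W]

/-- **«In particular, if `τ` is injective then `H_X` is smooth at `[Z]`»** ([BuchweitzFlenner2003, Thm. 7.9 (2) ∕ Thm. 7.3, last sentence];
[BandieraLepriManetti2023, §1]: «if the semiregularity map is injective, then `Z` has unobstructed embedded deformations»), abstract form:
a COMPLETE obstruction theory `(V, v_e)` of `F` killed by an INJECTIVE `k`-linear `θ : V → W` has all `v_e = 0` (`θ ⊗ Id_M` is injective,
`M` flat over `k`), so `F` lifts along every small extension. [cite: BuchweitzFlenner2003, Thm. 7.9 (2) and Thm. 7.3]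
[cite: BandieraLepriManetti2023, §1 (arXiv p0001:L40–41)] [cite: Manetti1999DeformationTheoryDGLA, Def. 2.13 and Prop. 2.18] -/
theorem ArtinFunctor.ObstructionTheory.isSmoothSmall_of_annihilates_of_injective (OF : F.ObstructionTheory V) (hOF : OF.IsComplete)
    (θ : V →ₗ[k] W) (h : ∀ ⦃R₁ R₀ : ArtAlg.{u} k⦄ (p : R₁ →ₐ[k] R₀) (hp : IsSmallExt k p) (a : F.obj R₀), θ.rTensor (kerₖ k p) (OF.ob p hp a) = 0)
    (hθ : Function.Injective θ) : F.IsSmoothSmall := fun _ _ p hp a =>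
  hOF p hp a (Module.Flat.rTensor_preserves_injective_linearMap θ hθ (by rw [map_zero]; exact h p hp a))

/-- … hence `F` is SMOOTH (surjective on all surjections of `Art_k`): small extensions suffice ([Schlessinger1968, Remarks (2.3)];
[StacksProject, Tag 06HH]; tree `ArtinFunctor.map_surjective_of_maximalIdeal_mul_ker`).
[cite: BuchweitzFlenner2003, Thm. 7.9 (2)] [cite: Schlessinger1968, Remarks (2.3)] [cite: StacksProject, Tag 06HH] -/
theorem ArtinFunctor.ObstructionTheory.isSmooth_of_annihilates_of_injective (OF : F.ObstructionTheory V) (hOF : OF.IsComplete)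
    (θ : V →ₗ[k] W) (h : ∀ ⦃R₁ R₀ : ArtAlg.{u} k⦄ (p : R₁ →ₐ[k] R₀) (hp : IsSmallExt k p) (a : F.obj R₀), θ.rTensor (kerₖ k p) (OF.ob p hp a) = 0)
    (hθ : Function.Injective θ) : F.IsSmooth := fun _ _ p hp =>
  F.map_surjective_of_maximalIdeal_mul_ker
    (fun _ _ q hq hqk => OF.isSmoothSmall_of_annihilates_of_injective hOF θ h hθ q ⟨hq, hqk⟩) p hp

namespace ProRep

/-- **[BuchweitzFlenner2003, Prop. 6.13 (2) ∕ Cor. 6.15] SHAPE — «`dim S ≥ dim_ℂ Ex(a₀, ℂ) − dim_ℂ K`, `K := ker(Ob(a, ℂ) → G(ℂ))`» —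
in [FantechiManetti1998ObstructionCalculus]'s language, for ONE presented hull:** `R = k[[x_1, …, x_n]]∕I` with `I ⊆ 𝔪²` (so
`n = dim T¹`), `ν : h_R → F` natural and smooth on small extensions, `(V, v_e)` a COMPLETE obstruction theory of `F`, and a `k`-linear
`θ : V → W` with `dim_k ker θ < ∞` such that `(θ ⊗ Id_M)(v_e(a)) = 0` for every small extension `e` and every `a` («the obstructions … are
contained in the kernel of the induced map», [IaconoManetti2013SemiregularityCI, §6]). THEN `I` is generated by at most `dim_k ker θ`
power series and **`n ≤ dim R + dim_k ker θ`** (`(ker θ, v_e)` is again complete — tree `ObstructionTheory.restrictKer` —, then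
[Hartshorne2010, Ex. 15.5 (b) ∕ Thm. 11.1], tree `powerSeries_le_ringKrullDim_add_finrank_of_isSmoothMapSmall`). [cite: BuchweitzFlenner2003, Prop. 6.13 (2) (arXiv p0030:L154–156) and Cor. 6.15] [cite: IaconoManetti2013SemiregularityCI, §6 (p. 14)]
[cite: Hartshorne2010, §15 Ex. 15.5 (b) (chunk p0126:L9) and §11 Thm. 11.1 ∕ Cor. 11.2] [cite: FantechiManetti1998ObstructionCalculus, Example 6.7] -/
theorem powerSeries_le_ringKrullDim_add_finrank_ker_of_annihilates {n : ℕ}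
    (I : Ideal (MvPowerSeries (Fin n) k)) (hI : I ≤ (IsLocalRing.maximalIdeal (MvPowerSeries (Fin n) k)) ^ 2)
    (F : ArtinFunctor.{u} k)
    (ν : ∀ R : ArtAlg.{u} k, (ArtinFunctor.points (k := k) (MvPowerSeries (Fin n) k ⧸ I)).obj R → F.obj R)
    (hν : (ArtinFunctor.points (k := k) (MvPowerSeries (Fin n) k ⧸ I)).IsNatural F ν)
    (hs : (ArtinFunctor.points (k := k) (MvPowerSeries (Fin n) k ⧸ I)).IsSmoothMapSmall F ν)
    {V W : Type u} [AddCommGroup V] [Module k V] [AddCommGroup W] [Module k W]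
    (OF : F.ObstructionTheory V) (hOF : OF.IsComplete) (θ : V →ₗ[k] W) [FiniteDimensional k (LinearMap.ker θ)]
    (h : ∀ ⦃R₁ R₀ : ArtAlg.{u} k⦄ (p : R₁ →ₐ[k] R₀) (hp : IsSmallExt k p) (a : F.obj R₀), θ.rTensor (kerₖ k p) (OF.ob p hp a) = 0) :
    (∃ s : Finset (MvPowerSeries (Fin n) k), Ideal.span (s : Set (MvPowerSeries (Fin n) k)) = I ∧
      s.card ≤ Module.finrank k (LinearMap.ker θ)) ∧
      (n : WithBot ℕ∞) ≤ ringKrullDim (MvPowerSeries (Fin n) k ⧸ I) + Module.finrank k (LinearMap.ker θ) :=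
  powerSeries_le_ringKrullDim_add_finrank_of_isSmoothMapSmall I hI F ν hν hs (OF.restrictKer θ h)
    ((OF.restrictKer_isComplete_iff θ h).2 hOF)

/-- **`ker θ = 0` ⇒ `I = 0`**: with every obstruction killed by an INJECTIVE `θ`, the presented hull is the power series ring itself
(«cut out by at most `dim ker θ = 0` equations»; the dimension-count form of [BuchweitzFlenner2003, Thm. 7.3 ∕ 7.9] «if `τ` is
injective then `S` is smooth»). [cite: BuchweitzFlenner2003, Prop. 6.13 (2), Thm. 7.3 (last sentence), Thm. 7.9]
[cite: Hartshorne2010, §11 Thm. 11.1 (chunk p0100:L17)] -/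
theorem powerSeries_ideal_eq_bot_of_annihilates_of_ker_eq_bot {n : ℕ}
    (I : Ideal (MvPowerSeries (Fin n) k)) (hI : I ≤ (IsLocalRing.maximalIdeal (MvPowerSeries (Fin n) k)) ^ 2)
    (F : ArtinFunctor.{u} k)
    (ν : ∀ R : ArtAlg.{u} k, (ArtinFunctor.points (k := k) (MvPowerSeries (Fin n) k ⧸ I)).obj R → F.obj R)
    (hν : (ArtinFunctor.points (k := k) (MvPowerSeries (Fin n) k ⧸ I)).IsNatural F ν)
    (hs : (ArtinFunctor.points (k := k) (MvPowerSeries (Fin n) k ⧸ I)).IsSmoothMapSmall F ν)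
    {V W : Type u} [AddCommGroup V] [Module k V] [AddCommGroup W] [Module k W]
    (OF : F.ObstructionTheory V) (hOF : OF.IsComplete) (θ : V →ₗ[k] W)
    (h : ∀ ⦃R₁ R₀ : ArtAlg.{u} k⦄ (p : R₁ →ₐ[k] R₀) (hp : IsSmallExt k p) (a : F.obj R₀), θ.rTensor (kerₖ k p) (OF.ob p hp a) = 0)
    (hker : LinearMap.ker θ = ⊥) : I = ⊥ := by
  haveI : FiniteDimensional k (LinearMap.ker θ) := by rw [hker]; infer_instance
  obtain ⟨⟨s, hsI, hcard⟩, -⟩ := powerSeries_le_ringKrullDim_add_finrank_ker_of_annihilates I hI F ν hν hs OF hOF θ h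
  rw [hker, finrank_bot, Nat.le_zero, Finset.card_eq_zero] at hcard
  rw [← hsI, hcard, Finset.coe_empty, Ideal.span_empty]

end ProRep

end Generic

/-! ## §1 `H_Z^X`, presented-hull form: obstructions in `ker θ ⊆ H¹(Z, 𝒩_{Z/X})` ⇒ `n ≤ dim (k[[x]]/I) + dim ker θ` -/

section LocalHilbert

variable {k : Type u} [Field k] (X : Motives.SchemeOver k) {Z : Scheme.{u}} (ι₀ : Z ⟶ X.left) [IsClosedImmersion ι₀]
  [IsLocallyNoetherian X.left]

/-- **[BuchweitzFlenner2003, Prop. 6.13 (2)] SHAPE for the local Hilbert functor, presented-hull form.** For `Z ≠ ∅` closed in a locally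
Noetherian `k`-scheme `X` with lifts existing locally (Thm. 6.2 (b)'s `hloc`), a `k`-linear `θ : H¹(Z, 𝒩_{Z∕X}) → W` with `dim_k ker θ < ∞`
KILLING EVERY OBSTRUCTION of `H_Z^X` (`(θ ⊗ 1)(ob(y, p)) = 0`, obstruction theory `localHilbertFunctor.normalObstructionTheory`), and any
`ν : h_{k[[x_1..x_n]]∕I} → H_Z^X`, `I ⊆ 𝔪²`, natural and smooth on small extensions: `I` is generated by at most `dim_k ker θ` power series and
**`n ≤ dim (k[[x]]∕I) + dim_k ker θ`**. [cite: BuchweitzFlenner2003, Prop. 6.13 (2) (arXiv p0030:L154–156)] [cite: Hartshorne2010, Thm. 6.2 (b)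
p. 47, §11 Thm. 11.1 ∕ Cor. 11.2, §15 Ex. 15.5 (b)] [cite: IaconoManetti2013SemiregularityCI, §6 (p. 14)] -/
theorem localHilbertFunctor.powerSeries_le_ringKrullDim_add_finrank_ker_of_annihilates
    (hloc : ∀ ⦃A' A : ArtAlg.{u} k⦄ (p : A' →ₐ[k] A), IsSmallExt k p → ∀ (y : (localHilbertFunctor X ι₀.ker).obj A) (z : Z),
      ∃ V : Z.Opens, z ∈ V ∧ Nonempty (liftsOver X ι₀ p y V)) [Nonempty Z] {n : ℕ}
    (I : Ideal (MvPowerSeries (Fin n) k)) (hI : I ≤ (IsLocalRing.maximalIdeal (MvPowerSeries (Fin n) k)) ^ 2)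
    (ν : ∀ R : ArtAlg.{u} k,
      (ArtinFunctor.points (k := k) (MvPowerSeries (Fin n) k ⧸ I)).obj R → (localHilbertFunctor X ι₀.ker).obj R)
    (hν : (ArtinFunctor.points (k := k) (MvPowerSeries (Fin n) k ⧸ I)).IsNatural (localHilbertFunctor X ι₀.ker) ν)
    (hs : (ArtinFunctor.points (k := k) (MvPowerSeries (Fin n) k ⧸ I)).IsSmoothMapSmall (localHilbertFunctor X ι₀.ker) ν)
    {W : Type u} [AddCommGroup W] [Module k W]
    (θ : letI := normalCohomologyModuleK X ι₀ 1; HodgeTheory.normalSheafCohomology ι₀ 1 →ₗ[k] W)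
    (hfin : letI := normalCohomologyModuleK X ι₀ 1; FiniteDimensional k (LinearMap.ker θ))
    (hθ : letI := normalCohomologyModuleK X ι₀ 1
      ∀ ⦃A' A : ArtAlg.{u} k⦄ (p : A' →ₐ[k] A) (hp : IsSmallExt k p) (y : (localHilbertFunctor X ι₀.ker).obj A),
        θ.rTensor (kerₖ k p) ((localHilbertFunctor.normalObstructionTheory X ι₀ hloc).ob p hp y) = 0) :
    letI := normalCohomologyModuleK X ι₀ 1
    (∃ s : Finset (MvPowerSeries (Fin n) k), Ideal.span (s : Set (MvPowerSeries (Fin n) k)) = I ∧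
      s.card ≤ Module.finrank k (LinearMap.ker θ)) ∧
      (n : WithBot ℕ∞) ≤ ringKrullDim (MvPowerSeries (Fin n) k ⧸ I) + Module.finrank k (LinearMap.ker θ) := by
  letI := normalCohomologyModuleK X ι₀ 1; haveI := hfin
  exact ProRep.powerSeries_le_ringKrullDim_add_finrank_ker_of_annihilates I hI (localHilbertFunctor X ι₀.ker) ν hν hs
    (localHilbertFunctor.normalObstructionTheory X ι₀ hloc) (localHilbertFunctor.normalObstructionTheory_isComplete X ι₀ hloc) θ hθ

/-- **«if `τ` is injective then `H_X` is smooth at `[Z]`»** for `H_Z^X` ([BuchweitzFlenner2003, Thm. 7.9 (2)]; [BandieraLepriManetti2023, §1]: «if the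
semiregularity map is injective, then `Z` has unobstructed embedded deformations in `X`»), abstract form: `Z ≠ ∅`, lifts existing locally,
an INJECTIVE `k`-linear `θ` on `H¹(Z, 𝒩_{Z∕X})` killing every obstruction ⇒ `H_Z^X` is SMOOTH (no hull, no finiteness needed).
[cite: BuchweitzFlenner2003, Thm. 7.9 (2)] [cite: BandieraLepriManetti2023, §1 (arXiv p0001:L40–41)] [cite: Hartshorne2010, Thm. 6.2 (b) p. 47] -/
theorem localHilbertFunctor_isSmooth_of_annihilates_of_injective
    (hloc : ∀ ⦃A' A : ArtAlg.{u} k⦄ (p : A' →ₐ[k] A), IsSmallExt k p → ∀ (y : (localHilbertFunctor X ι₀.ker).obj A) (z : Z),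
      ∃ V : Z.Opens, z ∈ V ∧ Nonempty (liftsOver X ι₀ p y V)) [Nonempty Z]
    {W : Type u} [AddCommGroup W] [Module k W]
    (θ : letI := normalCohomologyModuleK X ι₀ 1; HodgeTheory.normalSheafCohomology ι₀ 1 →ₗ[k] W)
    (hθ : letI := normalCohomologyModuleK X ι₀ 1
      ∀ ⦃A' A : ArtAlg.{u} k⦄ (p : A' →ₐ[k] A) (hp : IsSmallExt k p) (y : (localHilbertFunctor X ι₀.ker).obj A),
        θ.rTensor (kerₖ k p) ((localHilbertFunctor.normalObstructionTheory X ι₀ hloc).ob p hp y) = 0)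
    (hinj : Function.Injective θ) :
    (localHilbertFunctor X ι₀.ker).IsSmooth := by
  letI := normalCohomologyModuleK X ι₀ 1
  exact (localHilbertFunctor.normalObstructionTheory X ι₀ hloc).isSmooth_of_annihilates_of_injective
    (localHilbertFunctor.normalObstructionTheory_isComplete X ι₀ hloc) θ hθ hinj

variable {c : ℕ} (hreg : HodgeTheory.IsRegularImmersionOfCodim ι₀ c)

/-- **`θ` injective ⇒ `H_Z^X` smooth, for a local complete intersection `Z ↪ X`** (`Z ≠ ∅`; [BuchweitzFlenner2003, Thm. 7.9 (2) with
Rem. 7.11 (1)]; [BandieraLepriManetti2023, §1]) — from the kernel hypothesis on `θ`, no Hodge theory inside.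
[cite: BuchweitzFlenner2003, Thm. 7.9 (2) and Rem. 7.11 (1)] [cite: BandieraLepriManetti2023, §1] [cite: Hartshorne2010, Cor. 9.3 p. 85] -/
theorem localHilbertFunctor_isSmooth_of_annihilates_of_injective_of_isRegularImmersionOfCodim [Nonempty Z]
    {W : Type u} [AddCommGroup W] [Module k W]
    (θ : letI := normalCohomologyModuleK X ι₀ 1; HodgeTheory.normalSheafCohomology ι₀ 1 →ₗ[k] W)
    (hθ : letI := normalCohomologyModuleK X ι₀ 1
      ∀ ⦃A' A : ArtAlg.{u} k⦄ (p : A' →ₐ[k] A) (hp : IsSmallExt k p) (y : (localHilbertFunctor X ι₀.ker).obj A),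
        θ.rTensor (kerₖ k p) ((localHilbertFunctor.normalObstructionTheoryOfRegularImmersion X ι₀ hreg).ob p hp y) = 0)
    (hinj : Function.Injective θ) :
    (localHilbertFunctor X ι₀.ker).IsSmooth :=
  localHilbertFunctor_isSmooth_of_annihilates_of_injective X ι₀ _ θ hθ hinj

end LocalHilbert

/-! ## §2 `Z ⊂ X` a proper local complete intersection: the HULL `R = k[[x_1, …, x_{h⁰(𝒩)}]]/J` has `h⁰(𝒩) ≤ dim R + dim ker θ`
([BuchweitzFlenner2003, Thm. 7.9 (2)] shape); `θ` injective ⇒ `J = 0` -/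

section ProperLCI

variable {k : Type u} [Field k] (X : Motives.SchemeOver k) {Z : Scheme.{u}} (ι₀ : Z ⟶ X.left) [IsClosedImmersion ι₀]
  [IsLocallyNoetherian X.left] [IsProper (ι₀ ≫ X.hom)] [Nonempty Z] {c : ℕ} (hreg : HodgeTheory.IsRegularImmersionOfCodim ι₀ c)

/-- **[BuchweitzFlenner2003, Thm. 7.9 (2) with Rem. 7.11 (1)] SHAPE for the HULL of the local Hilbert functor of a PROPER local complete
intersection `Z ⊂ X`** («If `Z` is compact then `dim_{[Z]} H_X ≥ dim_ℂ T¹_{X∕Z}(𝒪_Z) − dim_ℂ ker τ`», `T¹ = H⁰(Z, 𝒩)`, `T² = H¹(Z, 𝒩)` for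
lci `Z`), the map being ABSTRACT: for `Z ≠ ∅` a proper regular immersion of constant codimension `c` into a locally Noetherian `k`-scheme
and ANY `k`-linear `θ : H¹(Z, 𝒩_{Z∕X}) → W` with `dim_k ker θ < ∞` whose kernel contains every obstruction (`(θ ⊗ 1)(ob(y, p)) = 0`, theory of
[Hartshorne2010, Cor. 9.3]; ASSUMED — in print [BandieraLepriManetti2023, Cor. 1.2] for Bloch's `π`): the hull `R = k[[x_1, …, x_n]]∕J` of
`H_Z^X` (tree `localHilbertFunctor_hull_ringForm_of_isProper`: **`n = h⁰(Z, 𝒩_{Z∕X})`**, `J ⊆ 𝔫²`, `ν = u ↦ u_* ξ̂` natural, smooth, bijective on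
`k[ε]`-points) has `J` generated by at most `dim_k ker θ` power series and **`h⁰(Z, 𝒩_{Z∕X}) ≤ dim R + dim_k ker θ`**.
[cite: BuchweitzFlenner2003, Thm. 7.9 (2) (arXiv p0034:L1–3), Rem. 7.11 (1), Prop. 6.13 (2)] [cite: BandieraLepriManetti2023, Cor. 1.2]
[cite: Hartshorne2010, §11 Thm. 11.3 (chunk p0101:L11–13), §15 Ex. 15.5 (b), §17 Thm. 17.1, Cor. 9.3] [cite: Schlessinger1968, Thm. 2.11 (1)] -/
theorem localHilbertFunctor_hull_dimension_bound_of_annihilates {W : Type u} [AddCommGroup W] [Module k W]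
    (θ : letI := normalCohomologyModuleK X ι₀ 1; HodgeTheory.normalSheafCohomology ι₀ 1 →ₗ[k] W)
    (hfin : letI := normalCohomologyModuleK X ι₀ 1; FiniteDimensional k (LinearMap.ker θ))
    (hθ : letI := normalCohomologyModuleK X ι₀ 1
      ∀ ⦃A' A : ArtAlg.{u} k⦄ (p : A' →ₐ[k] A) (hp : IsSmallExt k p) (y : (localHilbertFunctor X ι₀.ker).obj A),
        θ.rTensor (kerₖ k p) ((localHilbertFunctor.normalObstructionTheoryOfRegularImmersion X ι₀ hreg).ob p hp y) = 0) :
    letI := normalCohomologyModuleK X ι₀ 0; letI := normalCohomologyModuleK X ι₀ 1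
    ∃ (n : ℕ) (_ : n = Module.finrank k (HodgeTheory.normalSheafCohomology ι₀ 0))
      (_ : IsNoetherianRing (MvPowerSeries (Fin n) k))
      (_ : IsAdicComplete (maximalIdeal (MvPowerSeries (Fin n) k)) (MvPowerSeries (Fin n) k))
      (st₂ : (localHilbertFunctor X ι₀.ker).TowerStage (MvPowerSeries (Fin n) k))
      (_ : IsLocalRing (HullRing.Ring (localHilbertFunctor_H1 X ι₀.ker) (ArtinFunctor.hullBaseAug (k := k) n) st₂))
      (_ : HullRing.hullIdeal (localHilbertFunctor_H1 X ι₀.ker) (ArtinFunctor.hullBaseAug (k := k) n) st₂ ≤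
        maximalIdeal (MvPowerSeries (Fin n) k) ^ 2),
      (ArtinFunctor.points (k := k) (HullRing.Ring (localHilbertFunctor_H1 X ι₀.ker) (ArtinFunctor.hullBaseAug (k := k) n) st₂)).IsNatural
        (localHilbertFunctor X ι₀.ker) (fun _ u => HullRing.eval (localHilbertFunctor_H1 X ι₀.ker) (ArtinFunctor.hullBaseAug (k := k) n) st₂ u) ∧
      (ArtinFunctor.points (k := k) (HullRing.Ring (localHilbertFunctor_H1 X ι₀.ker) (ArtinFunctor.hullBaseAug (k := k) n) st₂)).IsSmoothMap
        (localHilbertFunctor X ι₀.ker) (fun _ u => HullRing.eval (localHilbertFunctor_H1 X ι₀.ker) (ArtinFunctor.hullBaseAug (k := k) n) st₂ u) ∧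
      (Function.Bijective fun φ : HullRing.Ring (localHilbertFunctor_H1 X ι₀.ker) (ArtinFunctor.hullBaseAug (k := k) n) st₂ →ₐ[k]
          ↥(ArtAlg.sqZeroExt (k := k) k) =>
        HullRing.eval (localHilbertFunctor_H1 X ι₀.ker) (ArtinFunctor.hullBaseAug (k := k) n) st₂ φ) ∧
      (∃ s : Finset (MvPowerSeries (Fin n) k),
        Ideal.span (s : Set (MvPowerSeries (Fin n) k)) =
          HullRing.hullIdeal (localHilbertFunctor_H1 X ι₀.ker) (ArtinFunctor.hullBaseAug (k := k) n) st₂ ∧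
        s.card ≤ Module.finrank k (LinearMap.ker θ)) ∧
      (Module.finrank k (HodgeTheory.normalSheafCohomology ι₀ 0) : WithBot ℕ∞) ≤
        ringKrullDim (HullRing.Ring (localHilbertFunctor_H1 X ι₀.ker) (ArtinFunctor.hullBaseAug (k := k) n) st₂) +
          Module.finrank k (LinearMap.ker θ) := by
  letI := normalCohomologyModuleK X ι₀ 0; letI := normalCohomologyModuleK X ι₀ 1
  obtain ⟨n, hn, hS, hcS, st₂, hlocR, -, hJ, hnat, hsm, hsms, hbij⟩ := localHilbertFunctor_hull_ringForm_of_isProper X ι₀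
  obtain ⟨hgen, hdim⟩ :=
    localHilbertFunctor.powerSeries_le_ringKrullDim_add_finrank_ker_of_annihilates X ι₀ _
      (HullRing.hullIdeal (localHilbertFunctor_H1 X ι₀.ker) (ArtinFunctor.hullBaseAug (k := k) n) st₂) hJ _ hnat hsms θ hfin hθ
  refine ⟨n, hn, hS, hcS, st₂, hlocR, hJ, hnat, hsm, hbij, hgen, ?_⟩
  rw [← hn]
  exact hdim

/-- **[BuchweitzFlenner2003, Thm. 7.9] «In particular, if `τ` is injective then `H_X` is smooth at `[Z]`» ∕ [Cor. 7.10], HULL FORM, from the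
kernel hypothesis:** for a proper local complete intersection `Z ⊂ X` (`Z ≠ ∅`) and an INJECTIVE `k`-linear `θ` on `H¹(Z, 𝒩_{Z∕X})` killing
every obstruction, the hull `R = k[[x_1, …, x_n]]∕J` of `H_Z^X`, `n = h⁰(Z, 𝒩_{Z∕X})`, has **`J = 0`** — `H_Z^X` has the formal power series
ring in `h⁰(Z, 𝒩_{Z∕X})` variables as a hull — and `H_Z^X` is SMOOTH (the tree's `…_prorepresentable_powerSeries_of_isBlochSemiregular`
reaches `J = 0` from the named FACT `Bloch1972_hilbertScheme_smoothAt_semiregular`; here from the kernel statement for an abstract `θ`). [cite: BuchweitzFlenner2003, Thm. 7.9 (2), Cor. 7.10, Rem. 7.11 (1)] [cite: BandieraLepriManetti2023, §1 and Cor. 1.2]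
[cite: Schlessinger1968, Remark 2.10 and Thm. 2.11 (1)] [cite: Hartshorne2010, §17 Thm. 17.1, §11 Thm. 11.3] -/
theorem localHilbertFunctor_hullIdeal_eq_bot_of_annihilates_of_injective {W : Type u} [AddCommGroup W] [Module k W]
    (θ : letI := normalCohomologyModuleK X ι₀ 1; HodgeTheory.normalSheafCohomology ι₀ 1 →ₗ[k] W)
    (hθ : letI := normalCohomologyModuleK X ι₀ 1
      ∀ ⦃A' A : ArtAlg.{u} k⦄ (p : A' →ₐ[k] A) (hp : IsSmallExt k p) (y : (localHilbertFunctor X ι₀.ker).obj A),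
        θ.rTensor (kerₖ k p) ((localHilbertFunctor.normalObstructionTheoryOfRegularImmersion X ι₀ hreg).ob p hp y) = 0)
    (hinj : Function.Injective θ) :
    letI := normalCohomologyModuleK X ι₀ 0
    (∃ (n : ℕ) (_ : n = Module.finrank k (HodgeTheory.normalSheafCohomology ι₀ 0))
      (_ : IsNoetherianRing (MvPowerSeries (Fin n) k))
      (_ : IsAdicComplete (maximalIdeal (MvPowerSeries (Fin n) k)) (MvPowerSeries (Fin n) k))
      (st₂ : (localHilbertFunctor X ι₀.ker).TowerStage (MvPowerSeries (Fin n) k))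
      (_ : IsLocalRing (HullRing.Ring (localHilbertFunctor_H1 X ι₀.ker) (ArtinFunctor.hullBaseAug (k := k) n) st₂)),
      HullRing.hullIdeal (localHilbertFunctor_H1 X ι₀.ker) (ArtinFunctor.hullBaseAug (k := k) n) st₂ = ⊥ ∧
      (ArtinFunctor.points (k := k) (HullRing.Ring (localHilbertFunctor_H1 X ι₀.ker) (ArtinFunctor.hullBaseAug (k := k) n) st₂)).IsNatural
        (localHilbertFunctor X ι₀.ker) (fun _ u => HullRing.eval (localHilbertFunctor_H1 X ι₀.ker) (ArtinFunctor.hullBaseAug (k := k) n) st₂ u) ∧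
      (ArtinFunctor.points (k := k) (HullRing.Ring (localHilbertFunctor_H1 X ι₀.ker) (ArtinFunctor.hullBaseAug (k := k) n) st₂)).IsSmoothMap
        (localHilbertFunctor X ι₀.ker) (fun _ u => HullRing.eval (localHilbertFunctor_H1 X ι₀.ker) (ArtinFunctor.hullBaseAug (k := k) n) st₂ u) ∧
      (Function.Bijective fun φ : HullRing.Ring (localHilbertFunctor_H1 X ι₀.ker) (ArtinFunctor.hullBaseAug (k := k) n) st₂ →ₐ[k]
          ↥(ArtAlg.sqZeroExt (k := k) k) =>
        HullRing.eval (localHilbertFunctor_H1 X ι₀.ker) (ArtinFunctor.hullBaseAug (k := k) n) st₂ φ)) ∧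
    (localHilbertFunctor X ι₀.ker).IsSmooth := by
  letI := normalCohomologyModuleK X ι₀ 0; letI := normalCohomologyModuleK X ι₀ 1
  refine ⟨?_, localHilbertFunctor_isSmooth_of_annihilates_of_injective_of_isRegularImmersionOfCodim X ι₀ hreg θ hθ hinj⟩
  obtain ⟨n, hn, hS, hcS, st₂, hlocR, -, hJ, hnat, hsm, hsms, hbij⟩ := localHilbertFunctor_hull_ringForm_of_isProper X ι₀
  exact ⟨n, hn, hS, hcS, st₂, hlocR, ProRep.powerSeries_ideal_eq_bot_of_annihilates_of_ker_eq_bot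
    (HullRing.hullIdeal (localHilbertFunctor_H1 X ι₀.ker) (ArtinFunctor.hullBaseAug (k := k) n) st₂) hJ (localHilbertFunctor X ι₀.ker)
    _ hnat hsms (localHilbertFunctor.normalObstructionTheoryOfRegularImmersion X ι₀ hreg)
    (localHilbertFunctor.normalObstructionTheoryOfRegularImmersion_isComplete X ι₀ hreg) θ hθ (LinearMap.ker_eq_bot.2 hinj), hnat, hsm, hbij⟩

end ProperLCI

end Literature.AlgebraicGeometry.Deformation

/-! ## §3 Over `ℂ`, `X` smooth projective, `Z ↪ X` a regular immersion of codimension `p` (the binders of Bloch (7.3) ∕ BLM Cor. 1.2):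
the two conclusions for ANY `ℂ`-linear `θ` on `H¹(Z, 𝒩_{Z/X})` containing all obstructions in its kernel -/

namespace Literature.AlgebraicGeometry.HodgeTheory

open Literature.AlgebraicGeometry.Deformation Literature.AlgebraicGeometry.Motives

/-- **[BuchweitzFlenner2003, Thm. 7.9 (2)] ∕ [BandieraLepriManetti2023, Cor. 1.2] SHAPE, hull form, for `Z ⊂ X` a local complete intersection
in a smooth complex projective variety:** `X` smooth projective over `ℂ` of dimension `m`, `ι₀ : Z → X` a regular immersion of codimension `p`,
`Z ≠ ∅`, and ANY `ℂ`-linear `θ : H¹(Z, 𝒩_{Z∕X}) → W` with `dim ker θ < ∞` such that «every obstruction to embedded deformations of `Z` is contained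
in the kernel» of `θ` (HYPOTHESIS `hθ` — Cor. 1.2's conclusion, assumed for `θ`): the hull `R = ℂ[[x_1, …, x_n]]∕J` of `H_Z^X` has `n = h⁰(Z, 𝒩_{Z∕X})`,
`J ⊆ 𝔫²` generated by at most `dim ker θ` power series, and **`h⁰(Z, 𝒩_{Z∕X}) ≤ dim R + dim ker θ`**, `dim R = d ∈ ℕ`. [cite: BuchweitzFlenner2003,
Thm. 7.9 (2), Rem. 7.11 (1)] [cite: BandieraLepriManetti2023, Cor. 1.2 (p0003:L39–42)] [cite: Hartshorne2010, §11 Thm. 11.3] -/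
theorem localHilbertFunctor_hull_dimension_bound_of_annihilates_smoothProjective
    {X : Motives.SchemeOver ℂ} {m p : ℕ} (hX : Motives.IsSmoothProjective m X) {Z : Scheme.{0}} {ι₀ : Z ⟶ X.left}
    (hι : IsRegularImmersionOfCodim ι₀ p) [Nonempty Z] {W : Type} [AddCommGroup W] [Module ℂ W]
    (θ : haveI := hι.isClosedImmersion; letI := normalCohomologyModuleK X ι₀ 1; normalSheafCohomology ι₀ 1 →ₗ[ℂ] W)
    (hfin : haveI := hι.isClosedImmersion; letI := normalCohomologyModuleK X ι₀ 1; FiniteDimensional ℂ (LinearMap.ker θ))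
    (hθ : haveI := hι.isClosedImmersion; letI := normalCohomologyModuleK X ι₀ 1
      haveI : IsLocallyNoetherian X.left := IsSmoothProjective.isLocallyNoetherian_holds hX
      ∀ ⦃A' A : ArtAlg.{0} ℂ⦄ (q : A' →ₐ[ℂ] A) (hq : IsSmallExt ℂ q) (y : (localHilbertFunctor X ι₀.ker).obj A),
        θ.rTensor (kerₖ ℂ q) ((localHilbertFunctor.normalObstructionTheoryOfRegularImmersion X ι₀ hι).ob q hq y) = 0) :
    haveI := hι.isClosedImmersion; letI := normalCohomologyModuleK X ι₀ 0; letI := normalCohomologyModuleK X ι₀ 1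
    ∃ (n : ℕ) (_ : n = Module.finrank ℂ (normalSheafCohomology ι₀ 0))
      (_ : IsNoetherianRing (MvPowerSeries (Fin n) ℂ))
      (st₂ : (localHilbertFunctor X ι₀.ker).TowerStage (MvPowerSeries (Fin n) ℂ))
      (_ : HullRing.hullIdeal (localHilbertFunctor_H1 X ι₀.ker) (ArtinFunctor.hullBaseAug (k := ℂ) n) st₂ ≤
        maximalIdeal (MvPowerSeries (Fin n) ℂ) ^ 2) (d : ℕ),
      ringKrullDim (HullRing.Ring (localHilbertFunctor_H1 X ι₀.ker) (ArtinFunctor.hullBaseAug (k := ℂ) n) st₂) = d ∧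
      (∃ s : Finset (MvPowerSeries (Fin n) ℂ),
        Ideal.span (s : Set (MvPowerSeries (Fin n) ℂ)) =
          HullRing.hullIdeal (localHilbertFunctor_H1 X ι₀.ker) (ArtinFunctor.hullBaseAug (k := ℂ) n) st₂ ∧
        s.card ≤ Module.finrank ℂ (LinearMap.ker θ)) ∧
      Module.finrank ℂ (normalSheafCohomology ι₀ 0) ≤ d + Module.finrank ℂ (LinearMap.ker θ) := by
  haveI := hι.isClosedImmersion
  haveI : IsLocallyNoetherian X.left := IsSmoothProjective.isLocallyNoetherian_holds hX
  haveI : IsProper X.hom := IsSmoothProjective.isProper_holds hX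
  letI := normalCohomologyModuleK X ι₀ 0; letI := normalCohomologyModuleK X ι₀ 1
  obtain ⟨n, hn, hS, -, st₂, -, hJ, -, -, -, hgen, hdim⟩ :=
    localHilbertFunctor_hull_dimension_bound_of_annihilates X ι₀ hι θ hfin hθ
  obtain ⟨d, hd⟩ := ProRep.powerSeries_exists_ringKrullDim_quotient_eq
    (HullRing.hullIdeal (localHilbertFunctor_H1 X ι₀.ker) (ArtinFunctor.hullBaseAug (k := ℂ) n) st₂)
    (HullRing.hullIdeal_ne_top (localHilbertFunctor_H1 X ι₀.ker) (ArtinFunctor.hullBaseAug (k := ℂ) n) st₂)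
  refine ⟨n, hn, hS, st₂, hJ, d, hd, hgen, ?_⟩
  have h' := hdim
  rw [show ringKrullDim (HullRing.Ring (localHilbertFunctor_H1 X ι₀.ker) (ArtinFunctor.hullBaseAug (k := ℂ) n) st₂) =
    (d : WithBot ℕ∞) from hd] at h'
  exact_mod_cast h'

/-- **[Bloch1972Semiregularity, Thm. (7.3)] ∕ [BuchweitzFlenner2003, Cor. 7.10] ∕ [BandieraLepriManetti2023, §1] SHAPE — «if the semiregularity
map is injective, then `Z` has unobstructed embedded deformations in `X`» — with the map ABSTRACT and WITHOUT the typed Bloch fact:** for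
`X` smooth projective over `ℂ`, `ι₀ : Z → X` a regular immersion of codimension `p` with `Z ≠ ∅`, and an INJECTIVE `ℂ`-linear `θ` on
`H¹(Z, 𝒩_{Z∕X})` whose kernel contains every obstruction (so every obstruction vanishes), the local Hilbert functor `H_Z^X` is SMOOTH
(every embedded deformation over `B ∈ Art_ℂ` extends along every surjection `A ↠ B`). `θ := π` would need Bloch's `π` on this carrier and
[BandieraLepriManetti2023, Cor. 1.2], neither typed; the tree's route for semiregular `Z` is the named fact
`Bloch1972_hilbertScheme_smoothAt_semiregular` (`localHilbertFunctor_isSmooth_of_isBlochSemiregular`). [cite: Bloch1972Semiregularity, Thm. (7.3)] [cite: BuchweitzFlenner2003, Thm. 7.9 (2) and Cor. 7.10] [cite: BandieraLepriManetti2023, §1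
(arXiv p0001:L40–41) and Cor. 1.2] -/
theorem localHilbertFunctor_isSmooth_of_annihilates_of_injective_smoothProjective
    {X : Motives.SchemeOver ℂ} {m p : ℕ} (hX : Motives.IsSmoothProjective m X) {Z : Scheme.{0}} {ι₀ : Z ⟶ X.left}
    (hι : IsRegularImmersionOfCodim ι₀ p) [Nonempty Z] {W : Type} [AddCommGroup W] [Module ℂ W]
    (θ : haveI := hι.isClosedImmersion; letI := normalCohomologyModuleK X ι₀ 1; normalSheafCohomology ι₀ 1 →ₗ[ℂ] W)
    (hθ : haveI := hι.isClosedImmersion; letI := normalCohomologyModuleK X ι₀ 1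
      haveI : IsLocallyNoetherian X.left := IsSmoothProjective.isLocallyNoetherian_holds hX
      ∀ ⦃A' A : ArtAlg.{0} ℂ⦄ (q : A' →ₐ[ℂ] A) (hq : IsSmallExt ℂ q) (y : (localHilbertFunctor X ι₀.ker).obj A),
        θ.rTensor (kerₖ ℂ q) ((localHilbertFunctor.normalObstructionTheoryOfRegularImmersion X ι₀ hι).ob q hq y) = 0)
    (hinj : Function.Injective θ) :
    haveI := hι.isClosedImmersion
    haveI : IsLocallyNoetherian X.left := IsSmoothProjective.isLocallyNoetherian_holds hX
    (localHilbertFunctor X ι₀.ker).IsSmooth := by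
  haveI := hι.isClosedImmersion
  haveI : IsLocallyNoetherian X.left := IsSmoothProjective.isLocallyNoetherian_holds hX
  exact localHilbertFunctor_isSmooth_of_annihilates_of_injective_of_isRegularImmersionOfCodim X ι₀ hι θ hθ hinj

end Literature.AlgebraicGeometry.HodgeTheory

end
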